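import Summits.BirchSwinnertonDyer.Rank1Residual.Supersingular.KuriharaTwistSymbolKurihara
import Summits.BirchSwinnertonDyer.Rank1Residual.Supersingular.KuriharaTwistSchemaLevelK
import HarnessLib

/-!
# The plus symbol in CRT coordinates IV: DEPTH-`k` twist records (`TwistRecordK`, modulus `q = p^k`) —
# a consistent record with the true bins pins the tree's `kuriharaNumber f (p^k) n ψ` to the recorded residue

Cell `b2b-bsdres`, supersingular family, prover A = unit `b2b-bsdres-x10b` (gen 10).  Topic file; namespace
`Summit.BirchSwinnertonDyer.Rank1Residual.Supersingular.KuriharaTwist` (that of `TwistRecordK`, n1011-p09's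
depth-`k` schema `KuriharaTwistSchemaLevelK.lean`).  THEOREMS ONLY; no definition, no named fact, nothing
asserted about any curve, nothing booked; marks unchanged.

HONEST FRAMING (run/shared/lean/b2b/bsd-rank1-residual/, verbatim in every file): the goal of the
cell is to DELETE the COMBINATION-SHAPED residual classes of the Birch–Swinnerton-Dyer formula for
ALL analytic-rank `≤ 1` elliptic curves over `ℚ` — "full BSD formula for every rank `≤ 1` curve in
class `C`" assembled STRICTLY from published theorems — so that the rank-`≤ 1` remainder becomes
exactly the CONSTRUCTION-SHAPED classes, which are TYPED (missing-input `Prop`s), NOT attempted.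
This is not "finishing BSD".

## What this file proves

The depth-`k` twin of `TwistRecord.kuriharaNumber_ne_zero_of_consistent` (`KuriharaTwistSymbolKurihara.lean`,
Part V), for the records of the queued `p = 3` / depth-`k` twisted-`L` engine port (n1011 T-TW3, cc-eng-3 B-8e)
and for the level-`p^k` consumers (`X8KimLevelKRankOneOPEN`, `X8KimTamagawaDefectOPEN`: hypotheses
`kuriharaNumber D.f (3^k) n ψ ≠ 0`).  The depth-`k` recheck is MULTIPLICATIVE — `e_ν ≡ deltaMod·D·c_∞
(mod p^k)` — so the conclusion is SHARPER than non-vanishing: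

* `TwistRecordK.moment_eq_sum` — the schema's `foldl` moment as `Σ_j binom(j,t)·bins[j]`;
* `TwistRecordK.kuriharaNumber_eq_deltaMod_of_consistent` — a record passing `TwistRecordK.consistent`, a
  cusp form `f` whose plus symbol is Hecke-compatible (`A_ℓ ≡ 2 (mod p^k)`) and `p`-integral at the
  square-free level `n = r.n` (`ω(n) = #primes`), discrete logarithms `ψ_ℓ : (ℤ/ℓ)ˣ → ℤ/p^k`, and THE ONE
  identification hypothesis `hbins` (`bins[j] = D·c_∞·Σ_{a : m(a) = j} [a/n]⁺_f` for `j < p^k`,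
  `m(a) = (Σ_ℓ ψ_ℓ(a mod ℓ)).val`) ⟹ **`kuriharaNumber f (p^k) n ψ = deltaMod`** in `ℤ/p^k` (identity
  `Identity.sum_units_ratModP_ratPlusSymbol_mul_choose_eq` at modulus `p^k`; `D`, `c_∞` are units mod `p^k`);
* `TwistRecordK.kuriharaNumber_ne_zero_of_nonvanishing` — hence `≠ 0` when `deltaMod ≠ 0`, and
  `TwistRecordK.pow_dvd_iff` — `ord_p δ̃_n^{(k)} < v ⟺ p^v ∤ deltaMod` readings transfer verbatim (`ordLT`).

References: `KuriharaTwistSymbolKurihara.lean` (Part III identity, any `p^k`); n1011-p09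
`KuriharaTwistSchemaLevelK.lean`; C.-H. Kim, arXiv:2203.12159 §1.4 [Kim2022StructureSelmer]; C.-H. Kim (app.
R. Pollack) arXiv:2505.09121 §1.1.2 (`𝒩_k`) [Kim2025RefinedTNC, PREPRINT — notation only].
-/

namespace Summit.BirchSwinnertonDyer.Rank1Residual.Supersingular.KuriharaTwist

open Literature.NumberTheory.DiophantineGeometry.Dioph (ratModP)
open Literature.NumberTheory.EllipticCurves Literature.NumberTheory.EllipticCurves.ModularForms
open CongruenceSubgroup Finset
open scoped MatrixGroups ModularForm
open Summit.BirchSwinnertonDyer.BirchSwinnertonDyer.Theorems (deltaParity_ratModP_sum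
  deltaParity_ratModP_intCast_mul deltaParity_norm_sum_le deltaParity_norm_intCast_mul_le)

section RecordK

variable {N : ℕ} [NeZero N] (f : CuspForm (Gamma0 N) 2)

/-- `r.moment t = Σ_{j < #bins} binom(j, t) · bins[j]` for a depth-`k` record. [folklore] -/
theorem TwistRecordK.moment_eq_sum (r : TwistRecordK) (t : ℕ) :
    r.moment t = ∑ j ∈ Finset.range r.bins.length, (Nat.choose j t : ℤ) * r.bins.getD j 0 := by
  rw [TwistRecordK.moment, List.range_eq_range', foldl_zip_range'_eq]; simp

/-- **A CONSISTENT DEPTH-`k` TWIST RECORD WITH THE TRUE BINS PINS `δ̃_n^{(k)}` TO THE RECORDED RESIDUE.**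
`r` passes `TwistRecordK.consistent` (guards `3 ≤ p`, `1 ≤ k`, `ν = #primes < p`, `p ∤ D`, `#bins = p^k`,
structure congruences, and `e_ν ≡ deltaMod·D·c_∞ (mod p^k)`); `f`'s plus symbol has the Hecke relation with
eigenvalues `A_ℓ ≡ 2 (mod p^k)` at the primes of the square-free `n = r.n` (`ω(n) = ν`) and is `p`-integral at
every `z/d`, `d ∣ n`; IF the recorded bins are `D·c_∞·` the plus-symbol bins for `ψ` (`hbins`), THEN
`kuriharaNumber f (p^k) n ψ = deltaMod` in `ℤ/p^k`. [cite: Kim2022StructureSelmer, §1.4.3 (PDF p. 7)] -/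
theorem TwistRecordK.kuriharaNumber_eq_deltaMod_of_consistent (r : TwistRecordK) (hc : r.consistent = true)
    [hp : Fact r.p.Prime] [NeZero r.n] (hsq : Squarefree r.n) (hν : r.n.primeFactors.card = r.primes.length)
    (A : ℕ → ℤ)
    (hhecke : ∀ ℓ ∈ r.n.primeFactors, ∀ x : ℚ, (A ℓ : ℚ) * ratPlusSymbol f x =
      ∑ j : Fin ℓ, ratPlusSymbol f ((x + ((j : ℕ) : ℚ)) / (ℓ : ℚ)) + ratPlusSymbol f ((ℓ : ℚ) * x))
    (hA : ∀ ℓ ∈ r.n.primeFactors, ((A ℓ : ℤ) : ZMod (r.p ^ r.k)) = 2)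
    (hint : ∀ d : ℕ, d ∣ r.n → ∀ z : ℤ, ‖((ratPlusSymbol f ((z : ℚ) / (d : ℚ)) : ℚ) : ℚ_[r.p])‖ ≤ 1)
    (ψ : (ℓ : ℕ) → (ZMod ℓ)ˣ →* Multiplicative (ZMod (r.p ^ r.k)))
    (hbins : ∀ j < r.p ^ r.k, ((r.bins.getD j 0 : ℤ) : ℚ) = (r.den : ℚ) * (r.components : ℚ) *
      ∑ a ∈ (Finset.univ : Finset (ZMod r.n)ˣ).filter (fun a =>
        (∑ ℓ ∈ r.n.primeFactors.attach, Multiplicative.toAdd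
          (ψ ℓ.1 (ZMod.unitsMap (Nat.dvd_of_mem_primeFactors ℓ.2) a))).val = j),
        ratPlusSymbol f ((((a : ZMod r.n).val : ℕ) : ℚ) / (r.n : ℚ))) :
    kuriharaNumber f (r.p ^ r.k) r.n ψ = (r.deltaMod : ZMod (r.p ^ r.k)) := by
  -- unpack the recheck
  have hc' := hc
  simp only [TwistRecordK.consistent, TwistRecordK.modulus, Bool.and_eq_true, decide_eq_true_eq, beq_iff_eq,
    bne_iff_ne, ne_eq, Bool.or_eq_true] at hc'
  have hrec := hc'.2
  have hden : ¬ r.den % r.p = 0 := hc'.1.1.1.1.2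
  have hlen : r.bins.length = r.p ^ r.k := hc'.1.1.1.1.1.2
  have hcomp : r.components = 1 ∨ r.components = 2 := hc'.1.1.1.1.1.1.2
  have hνp : r.primes.length < r.p := hc'.1.1.1.1.1.1.1.1.2
  have h3 : 3 ≤ r.p := hc'.1.1.1.1.1.1.1.1.1.1.2
  -- (1) the recheck: `e_ν ≡ deltaMod·D·c_∞ (mod p^k)`
  have hrecZ : ((r.moment r.primes.length : ℤ) : ZMod (r.p ^ r.k)) =
      (r.deltaMod : ZMod (r.p ^ r.k)) * (((r.den : ℤ) : ZMod (r.p ^ r.k)) *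
        ((r.components : ℤ) : ZMod (r.p ^ r.k))) := by
    have hdvd : ((r.p ^ r.k : ℕ) : ℤ) ∣ r.moment r.primes.length -
        ((r.deltaMod * r.den * r.components : ℕ) : ℤ) := Int.dvd_of_emod_eq_zero hrec
    have := ((ZMod.intCast_eq_intCast_iff_dvd_sub _ _ (r.p ^ r.k)).mpr hdvd).symm
    rw [this]
    push_cast
    ring
  -- (2) the moment as a rational number, through the bins hypothesis, fibrewise
  have hm_lt : ∀ a : (ZMod r.n)ˣ, (∑ ℓ ∈ r.n.primeFactors.attach, Multiplicative.toAdd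
      (ψ ℓ.1 (ZMod.unitsMap (Nat.dvd_of_mem_primeFactors ℓ.2) a))).val < r.p ^ r.k := fun a =>
    ZMod.val_lt _
  have hmomQ : ((r.moment r.primes.length : ℤ) : ℚ) = (r.den : ℚ) * (r.components : ℚ) *
      ∑ a : (ZMod r.n)ˣ, (((∑ ℓ ∈ r.n.primeFactors.attach, Multiplicative.toAdd
        (ψ ℓ.1 (ZMod.unitsMap (Nat.dvd_of_mem_primeFactors ℓ.2) a))).val.choose r.primes.length : ℕ) : ℚ) *
        ratPlusSymbol f ((((a : ZMod r.n).val : ℕ) : ℚ) / (r.n : ℚ)) := by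
    rw [r.moment_eq_sum r.primes.length, hlen, Int.cast_sum]
    simp_rw [Int.cast_mul, Int.cast_natCast]
    rw [show ∑ j ∈ Finset.range (r.p ^ r.k), ((j.choose r.primes.length : ℕ) : ℚ) * ((r.bins.getD j 0 : ℤ) : ℚ) =
        ∑ j ∈ Finset.range (r.p ^ r.k), (r.den : ℚ) * (r.components : ℚ) *
          ∑ a ∈ (Finset.univ : Finset (ZMod r.n)ˣ).filter (fun a =>
            (∑ ℓ ∈ r.n.primeFactors.attach, Multiplicative.toAdd
              (ψ ℓ.1 (ZMod.unitsMap (Nat.dvd_of_mem_primeFactors ℓ.2) a))).val = j),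
            (((∑ ℓ ∈ r.n.primeFactors.attach, Multiplicative.toAdd
              (ψ ℓ.1 (ZMod.unitsMap (Nat.dvd_of_mem_primeFactors ℓ.2) a))).val.choose r.primes.length : ℕ) :
                ℚ) * ratPlusSymbol f ((((a : ZMod r.n).val : ℕ) : ℚ) / (r.n : ℚ)) from
      Finset.sum_congr rfl fun j hj => by
        rw [hbins j (Finset.mem_range.1 hj), Finset.mul_sum, Finset.mul_sum, Finset.mul_sum]
        refine Finset.sum_congr rfl fun a ha => ?_
        rw [(Finset.mem_filter.1 ha).2]
        ring]
    rw [← Finset.mul_sum, Finset.sum_fiberwise_of_maps_to (fun a _ => Finset.mem_range.2 (hm_lt a))]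
  -- (3) reduce modulo `p^k`: `\overline{e_ν} = D·c_∞·δ̃_n`
  have hintn : ∀ a : (ZMod r.n)ˣ, ‖((ratPlusSymbol f ((((a : ZMod r.n).val : ℕ) : ℚ) / (r.n : ℚ)) : ℚ) :
      ℚ_[r.p])‖ ≤ 1 := fun a => by
    have := hint r.n (dvd_refl r.n) ((a : ZMod r.n).val : ℤ)
    push_cast at this
    exact this
  have hid := Identity.sum_units_ratModP_ratPlusSymbol_mul_choose_eq f r.k hsq A hhecke hA hint ψ
    (by rw [hν]; exact hνp) r.primes.length (by rw [hν])
  rw [if_pos hν.symm] at hid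
  have hsumint : ∀ a : (ZMod r.n)ˣ, ‖(((((∑ ℓ ∈ r.n.primeFactors.attach, Multiplicative.toAdd
        (ψ ℓ.1 (ZMod.unitsMap (Nat.dvd_of_mem_primeFactors ℓ.2) a))).val.choose r.primes.length : ℕ) : ℚ) *
        ratPlusSymbol f ((((a : ZMod r.n).val : ℕ) : ℚ) / (r.n : ℚ)) : ℚ) : ℚ_[r.p])‖ ≤ 1 := fun a => by
    have := deltaParity_norm_intCast_mul_le
      (((∑ ℓ ∈ r.n.primeFactors.attach, Multiplicative.toAdd
        (ψ ℓ.1 (ZMod.unitsMap (Nat.dvd_of_mem_primeFactors ℓ.2) a))).val.choose r.primes.length : ℕ) : ℤ)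
      (hintn a)
    push_cast at this
    exact this
  have hS : ‖((∑ a : (ZMod r.n)ˣ, (((∑ ℓ ∈ r.n.primeFactors.attach, Multiplicative.toAdd
        (ψ ℓ.1 (ZMod.unitsMap (Nat.dvd_of_mem_primeFactors ℓ.2) a))).val.choose r.primes.length : ℕ) : ℚ) *
        ratPlusSymbol f ((((a : ZMod r.n).val : ℕ) : ℚ) / (r.n : ℚ)) : ℚ) : ℚ_[r.p])‖ ≤ 1 :=
    deltaParity_norm_sum_le _ fun a _ => hsumint a
  have hcS := deltaParity_norm_intCast_mul_le (r.components : ℤ) hS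
  have e1 : (r.den : ℚ) * (r.components : ℚ) *
      ∑ a : (ZMod r.n)ˣ, (((∑ ℓ ∈ r.n.primeFactors.attach, Multiplicative.toAdd
        (ψ ℓ.1 (ZMod.unitsMap (Nat.dvd_of_mem_primeFactors ℓ.2) a))).val.choose r.primes.length : ℕ) : ℚ) *
        ratPlusSymbol f ((((a : ZMod r.n).val : ℕ) : ℚ) / (r.n : ℚ)) =
      ((r.den : ℤ) : ℚ) * (((r.components : ℤ) : ℚ) *
      ∑ a : (ZMod r.n)ˣ, (((∑ ℓ ∈ r.n.primeFactors.attach, Multiplicative.toAdd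
        (ψ ℓ.1 (ZMod.unitsMap (Nat.dvd_of_mem_primeFactors ℓ.2) a))).val.choose r.primes.length : ℕ) : ℚ) *
        ratPlusSymbol f ((((a : ZMod r.n).val : ℕ) : ℚ) / (r.n : ℚ))) := by
    push_cast; ring
  have hred : ratModP (r.p ^ r.k) ((r.moment r.primes.length : ℤ) : ℚ) =
      ((r.den : ℤ) : ZMod (r.p ^ r.k)) * (((r.components : ℤ) : ZMod (r.p ^ r.k)) *
        kuriharaNumber f (r.p ^ r.k) r.n ψ) := by
    rw [hmomQ, e1, deltaParity_ratModP_intCast_mul r.k (r.den : ℤ) hcS,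
      deltaParity_ratModP_intCast_mul r.k (r.components : ℤ) hS,
      deltaParity_ratModP_sum r.k _ (fun a _ => hsumint a), ← hid]
    congr 2
    refine Finset.sum_congr rfl fun a _ => ?_
    have e2 : ((((∑ ℓ ∈ r.n.primeFactors.attach, Multiplicative.toAdd
          (ψ ℓ.1 (ZMod.unitsMap (Nat.dvd_of_mem_primeFactors ℓ.2) a))).val.choose r.primes.length : ℕ) : ℚ))
        = ((((∑ ℓ ∈ r.n.primeFactors.attach, Multiplicative.toAdd
          (ψ ℓ.1 (ZMod.unitsMap (Nat.dvd_of_mem_primeFactors ℓ.2) a))).val.choose r.primes.length : ℕ) : ℤ) :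
            ℚ) := by
      norm_cast
    rw [e2, deltaParity_ratModP_intCast_mul r.k _ (hintn a)]
    push_cast
    ring
  -- (4) compare and cancel the units `D`, `c_∞`
  rw [Literature.NumberTheory.EllipticCurves.ratModP_intCast, hrecZ] at hred
  have hDu : IsUnit (((r.den : ℤ) : ZMod (r.p ^ r.k))) := by
    rw [Int.cast_natCast, ZMod.isUnit_iff_coprime]
    exact (Nat.coprime_comm.mp ((Nat.Prime.coprime_iff_not_dvd hp.out).mpr
      (fun h => hden (Nat.mod_eq_zero_of_dvd h)))).pow_right r.k
  have hCu : IsUnit (((r.components : ℤ) : ZMod (r.p ^ r.k))) := by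
    rw [Int.cast_natCast, ZMod.isUnit_iff_coprime]
    refine Nat.Coprime.pow_right r.k ?_
    rcases hcomp with h1 | h2
    · rw [h1]; exact Nat.coprime_one_left _
    · rw [h2]
      exact (Nat.coprime_primes Nat.prime_two hp.out).mpr (by omega)
  have := hred
  rw [mul_comm (r.deltaMod : ZMod (r.p ^ r.k)), mul_assoc] at this
  -- this : D * (c * deltaMod) = D * (c * δ̃)   (up to the shape produced above)
  have h1 := hDu.mul_left_cancel this
  have h2 := hCu.mul_left_cancel h1
  exact h2.symm

/-- **… hence `δ̃_n^{(k)} ≠ 0` for a NON-VANISHING depth-`k` record** (`deltaMod ≠ 0`, `deltaMod < p^k`). [cite: Kim2022StructureSelmer, §1.4.3 (PDF p. 7)] -/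
theorem TwistRecordK.kuriharaNumber_ne_zero_of_nonvanishing (r : TwistRecordK) (hnv : r.nonvanishing = true)
    [hp : Fact r.p.Prime] [NeZero r.n] (hsq : Squarefree r.n) (hν : r.n.primeFactors.card = r.primes.length)
    (A : ℕ → ℤ)
    (hhecke : ∀ ℓ ∈ r.n.primeFactors, ∀ x : ℚ, (A ℓ : ℚ) * ratPlusSymbol f x =
      ∑ j : Fin ℓ, ratPlusSymbol f ((x + ((j : ℕ) : ℚ)) / (ℓ : ℚ)) + ratPlusSymbol f ((ℓ : ℚ) * x))
    (hA : ∀ ℓ ∈ r.n.primeFactors, ((A ℓ : ℤ) : ZMod (r.p ^ r.k)) = 2)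
    (hint : ∀ d : ℕ, d ∣ r.n → ∀ z : ℤ, ‖((ratPlusSymbol f ((z : ℚ) / (d : ℚ)) : ℚ) : ℚ_[r.p])‖ ≤ 1)
    (ψ : (ℓ : ℕ) → (ZMod ℓ)ˣ →* Multiplicative (ZMod (r.p ^ r.k)))
    (hbins : ∀ j < r.p ^ r.k, ((r.bins.getD j 0 : ℤ) : ℚ) = (r.den : ℚ) * (r.components : ℚ) *
      ∑ a ∈ (Finset.univ : Finset (ZMod r.n)ˣ).filter (fun a =>
        (∑ ℓ ∈ r.n.primeFactors.attach, Multiplicative.toAdd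
          (ψ ℓ.1 (ZMod.unitsMap (Nat.dvd_of_mem_primeFactors ℓ.2) a))).val = j),
        ratPlusSymbol f ((((a : ZMod r.n).val : ℕ) : ℚ) / (r.n : ℚ))) :
    kuriharaNumber f (r.p ^ r.k) r.n ψ ≠ 0 := by
  have hnv' := hnv
  simp only [TwistRecordK.nonvanishing, Bool.and_eq_true, decide_eq_true_eq] at hnv'
  obtain ⟨hc, hδ⟩ := hnv'
  have hlt : r.deltaMod < r.p ^ r.k := by
    have hc' := hc
    simp only [TwistRecordK.consistent, TwistRecordK.modulus, Bool.and_eq_true, decide_eq_true_eq] at hc'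
    exact hc'.1.1.2
  rw [r.kuriharaNumber_eq_deltaMod_of_consistent f hc hsq hν A hhecke hA hint ψ hbins]
  intro h0
  rw [ZMod.natCast_eq_zero_iff] at h0
  exact absurd (Nat.le_of_dvd hδ h0) (not_le.mpr hlt)

end RecordK

end Summit.BirchSwinnertonDyer.Rank1Residual.Supersingular.KuriharaTwist
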